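import Literature.NumberTheory.EllipticCurves.KummerInertiaSurjectiveProofs
import Literature.NumberTheory.EllipticCurves.QuadraticBaseChangeGaloisProofs
import Literature.NumberTheory.EllipticCurves.Agboola2007.RestrictedSelmerGroups
import HarnessLib

/-!
# Crux `PrintCf2.SplitBadTwoRankOneOfFacts` (stmt-BirchSwinnertonDyer-20368), road α v10.2 — brick B15 §2, file 2:
# WILD QUADRATIC RAMIFICATION BY AN EISENSTEIN ELEMENT, and the Kummer parity of a line's first layer

Cell `bsd-print-cf2`, width seat `bsd-line-cf2-p1-w6` g2 (prover-bsd-line-cf2-p1-w6-g2-0); `--supports stmt-BirchSwinnertonDyer-20368`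
(helper, Theses-free). HONEST FRAMING: nothing here closes the crux or a registered stub; BSD is not proved by any of this; no summit
statement is proved by this seat. No definition, no named fact, no `sorry`.

WHY. File 1 (`…RestrictedSelmerControlKernelExact`, p661620) makes the kernel term of S3c₂'s control identity `0` under (H7) «the
place `w₇ ∣ 7` does not split completely in the first layer `K₁` of the line `κ′`». Discharging (H7) for EVERY `ℤ₂`-line of
`K = ℚ(√−7)` unramified outside `v̄` (memo B15 §1 (C2): `K₁ = K(√−ᾱ₀)`) needs, besides Kummer theory at the TAME places (tree:
`dvd_log_valuation_of_absoluteGaloisGroup_inertia_fixes_root`), ONE fact at the WILD place `v ∣ 2`: `K(√β)/K` and `K(√−1)/K`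
are RAMIFIED at `v` (so the first layer, unramified at `v`, is neither). This file proves the wild fact by an Eisenstein element:
* §1 **`exists_mem_inertia_apply_eq_neg_of_sq_sub_uniformizer`** (any number field `k`, any Galois `Ω/k`, any finite place `w`,
  `u, c ∈ 𝓞 k` with `2c ∈ w` and `u − c²` a UNIFORMIZER at `w`, `η ∈ Ω` with `η² = u`, `𝔓 ∣ w` a prime of the integral closure):
  **some `σ ∈ I_𝔓` has `σ η = −η`.** Proof (the tree's `exists_mem_inertia_apply_eq_pow_mul_of_valuation_eq_exp`, steps 1–2,
  with a new step 3): in `L = k(η)` and `P = 𝔓 ∩ 𝓞_L`, the integer `z = η + c` satisfies `z (z − 2c) = u − c²`; both factors lie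
  in `P` (`z² = (u − c²) + 2c z ∈ P`), so `e(P ∣ w) = ord_P(u − c²) ≥ 2`; hence `#I_P(Gal(L/k)) = e ≥ 2` contains `g ≠ 1`, which
  must send `η ↦ −η`; lift `g` into `I_𝔓` (`GaloisRepresentations.exists_mul_mul_mem_inertia`). (`w ∣ 2`, `c = 1`: Eisenstein
  polynomial `X² − 2X − (u − 1)` of `z`; no parity hypothesis on `w` is needed.)
* §2 `exists_mem_inertia_smul_geomSqrt_eq_neg_of_sq_sub_uniformizer` — the case `Ω = K̄`, `η = √u`, `𝔓 ∈ w.primesAbove`, and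
  **`exists_mem_greenbergInertia_smul_geomSqrt_eq_neg_of_sq_sub_uniformizer`** — the tree's `GreenbergSelmer.inertia w`
  (`= I_{𝔓₀}`, `𝔓₀ = adicCompletionPrime K w`, `inertia_adicCompletionPrime_eq_map_absInertia`).
* §3 **`two_dvd_log_valuation_of_inertia_le_stabilizer`**: if `GreenbergSelmer.inertia w ≤ Stab(√γ)` then `2 ∣ ord_w(γ)` (every
  place, tame or wild: the tree's `dvd_log_valuation_of_absoluteGaloisGroup_inertia_fixes_root` with `ζ = −1`), and
  `not_inertia_le_stabilizer_geomSqrt_of_sq_sub_uniformizer` (the wild exclusion in stabiliser form).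
presearch: Lang *FDG* Ch. 6 Prop. 1.3 (tame Kummer criterion, held `book:lang1983-fundamentals-diophantine-geometry` p. 123); Serre
*Local Fields* I §6 Prop. 17–18 (Eisenstein polynomials generate totally ramified extensions); Neukirch ANT II (9.6) — held; no new
Literature fact filed. beyond-print theorem: no.

References: [SerreLocalFields1979] Ch. I §6 Prop. 17–18, Ch. I §7 Prop. 22; [Lang1983] Ch. 6 Prop. 1.3; [NeukirchANT1999] Ch. II
§9 Prop. (9.6); [Serre1972] §1.3.
-/

noncomputable section

open scoped Classical Pointwise IntermediateField NumberField

set_option linter.dupNamespace false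
set_option autoImplicit false

open NumberField IsDedekindDomain IntermediateField Field WeierstrassCurve
open Literature.NumberTheory.EllipticCurves Literature.NumberTheory.GaloisRepresentations

universe u

namespace Summit.BirchSwinnertonDyer.BirchSwinnertonDyer.Theorems.PrintCf2.FirstLayer

/-! ## §1. Wild quadratic ramification by an Eisenstein element -/

section Wild

variable {k : Type u} [Field k] [NumberField k] {Ω : Type u} [Field Ω] [Algebra k Ω] [IsGalois k Ω]

/-- **WILD QUADRATIC RAMIFICATION BY AN EISENSTEIN ELEMENT.** `k` a number field, `Ω/k` Galois, `w` a finite place, `u, c ∈ 𝓞 k` with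
`2c ∈ w` and `u − c²` a uniformizer at `w` (`ord_w(u − c²) = 1`), `η ∈ Ω` with `η² = u`, `𝔓` a prime of the integral closure of
`𝓞 k` in `Ω` above `w`. Then some `σ` in the inertia group `I_𝔓 ≤ Gal(Ω/k)` has `σ η = −η` (so `k(√u)/k` is ramified at `w`).
In `L = k(η)`, `P = 𝔓 ∩ 𝓞_L`: `z = η + c` has `z(z − 2c) = u − c²` with both factors in `P`, so `e(P ∣ w) ≥ 2 = [L : k]`, `I_P = Gal(L/k)`
(`#I_P = e`, Mathlib `Ideal.card_inertia_eq_ramificationIdxIn`), and the non-trivial element lifts to `I_𝔓`.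
[cite: SerreLocalFields1979, Ch. I §6 Prop. 17–18 and §7 Prop. 22] [cite: Lang1983, Ch. 6 Prop. 1.3] -/
theorem exists_mem_inertia_apply_eq_neg_of_sq_sub_uniformizer (w : HeightOneSpectrum (𝓞 k)) {u c : 𝓞 k}
    (h2c : 2 * c ∈ w.asIdeal) (hπ : w.intValuation (u - c ^ 2) = WithZero.exp (-1 : ℤ))
    {η : Ω} (hη : η ^ 2 = algebraMap k Ω (u : k)) (𝔓 : Ideal (integralClosure (𝓞 k) Ω)) [𝔓.IsPrime]
    [𝔓.LiesOver w.asIdeal] :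
    ∃ σ : Ω ≃ₐ[k] Ω, σ ∈ 𝔓.inertia (Ω ≃ₐ[k] Ω) ∧ σ η = -η := by
  classical
  -- ### the finite Galois extension `L = k(η)` and its arithmetic
  set L : IntermediateField k Ω := IntermediateField.adjoin k ({η} : Set Ω) with hLdef
  have hηint : IsIntegral k η := by
    refine IsIntegral.of_pow two_pos ?_
    rw [hη]
    exact isIntegral_algebraMap
  haveI : FiniteDimensional k L := IntermediateField.adjoin.finiteDimensional hηint
  have hconj : ∀ σ : Ω ≃ₐ[k] Ω, σ η = η ∨ σ η = -η := fun σ ↦ by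
    apply sq_eq_sq_iff_eq_or_eq_neg.mp
    rw [← map_pow, hη, AlgEquiv.commutes]
  haveI : Normal k L := by
    rw [IntermediateField.normal_iff_forall_map_le']
    intro σ
    rw [IntermediateField.adjoin_map, IntermediateField.adjoin_le_iff]
    rintro _ ⟨x, hx, rfl⟩
    rw [Set.mem_singleton_iff] at hx
    rw [hx]
    have hηL : η ∈ L := IntermediateField.subset_adjoin k _ (Set.mem_singleton η)
    change σ η ∈ (L : Set Ω)
    rcases hconj σ with h | h
    · rw [h]; exact hηL
    · rw [h]; exact neg_mem hηL
  haveI : IsGalois k L := ⟨⟩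
  haveI : NumberField L := NumberField.of_module_finite k L
  haveI : Module.Finite (𝓞 k) (𝓞 L) := IsIntegralClosure.finite (𝓞 k) k L (𝓞 L)
  haveI : IsGaloisGroup (L ≃ₐ[k] L) (𝓞 k) (𝓞 L) :=
    IsGaloisGroup.of_isFractionRing (L ≃ₐ[k] L) (𝓞 k) (𝓞 L) k L
  set G := L ≃ₐ[k] L
  have hηL : η ∈ L := IntermediateField.subset_adjoin k _ (Set.mem_singleton η)
  set η' : L := ⟨η, hηL⟩ with hη'def
  have hη'sq : η' ^ 2 = algebraMap k L (u : k) := by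
    apply (algebraMap L Ω).injective
    rw [map_pow, ← IsScalarTower.algebraMap_apply, ← hη]
    rfl
  have hη'int : IsIntegral ℤ η' := by
    refine IsIntegral.of_pow two_pos ?_
    rw [hη'sq]
    exact (RingOfIntegers.isIntegral_coe u).map (IsScalarTower.toAlgHom ℤ k L)
  -- the integer `z = η + c` of `L` with `z (z − 2c) = u − c²`
  set ηO : 𝓞 L := ⟨η', hη'int⟩ with hηOdef
  set cL : 𝓞 L := algebraMap (𝓞 k) (𝓞 L) c with hcLdef
  set z : 𝓞 L := ηO + cL with hzdef
  have hcoe : ∀ x : 𝓞 k, ((algebraMap (𝓞 k) (𝓞 L) x : 𝓞 L) : L) = algebraMap k L (x : k) := fun x ↦ by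
    change algebraMap (𝓞 L) L (algebraMap (𝓞 k) (𝓞 L) x) = algebraMap k L (algebraMap (𝓞 k) k x)
    rw [← IsScalarTower.algebraMap_apply (𝓞 k) (𝓞 L) L, IsScalarTower.algebraMap_apply (𝓞 k) k L]
  have hηO2 : ηO * ηO = algebraMap (𝓞 k) (𝓞 L) u := by
    apply RingOfIntegers.ext
    change η' * η' = ((algebraMap (𝓞 k) (𝓞 L) u : 𝓞 L) : L)
    rw [hcoe, ← sq, hη'sq]
  have hzz : z * (z - 2 * cL) = algebraMap (𝓞 k) (𝓞 L) (u - c ^ 2) := by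
    rw [map_sub, map_pow, ← hηO2, hzdef, hcLdef]
    ring
  -- ### the prime `P = 𝔓 ∩ 𝓞 L` below `𝔓`
  set ι := ringOfIntegersToIntegralClosure (k := k) (Ω := Ω) L with hιdef
  set P : Ideal (𝓞 L) := 𝔓.comap ι with hPdef
  haveI hPprime : P.IsPrime := Ideal.comap_isPrime ι 𝔓
  haveI hPover : P.LiesOver w.asIdeal := by
    constructor
    change w.asIdeal = Ideal.comap (algebraMap (𝓞 k) (𝓞 L)) (Ideal.comap ι 𝔓)
    rw [Ideal.comap_comap, hιdef, ringOfIntegersToIntegralClosure_comp_algebraMap]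
    exact Ideal.LiesOver.over
  have hPne : P ≠ ⊥ := Ideal.ne_bot_of_liesOver_of_ne_bot w.ne_bot P
  let wP : HeightOneSpectrum (𝓞 L) := ⟨P, hPprime, hPne⟩
  haveI : wP.asIdeal.LiesOver w.asIdeal := hPover
  have hmemP : ∀ x : 𝓞 k, x ∈ w.asIdeal → algebraMap (𝓞 k) (𝓞 L) x ∈ P := fun x hx ↦ by
    have h : x ∈ P.under (𝓞 k) := by rw [← hPover.over]; exact hx
    exact h
  set I : Subgroup G := P.inertia G with hIdef
  -- ### Step 1: every element of `I` lifts to `I_𝔓` with the same action on `L`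
  have hlift : ∀ g ∈ I, ∃ σ : Ω ≃ₐ[k] Ω, σ ∈ 𝔓.inertia (Ω ≃ₐ[k] Ω) ∧
      ∀ x : L, σ (x : Ω) = (g x : Ω) := by
    intro g hg
    rw [hIdef, Ideal.inertia, AddSubgroup.mem_inertia] at hg
    letI : TopologicalSpace (integralClosure (𝓞 k) Ω) := ⊥
    haveI : DiscreteTopology (integralClosure (𝓞 k) Ω) := ⟨rfl⟩
    haveI : ContinuousSMul (Ω ≃ₐ[k] Ω) (integralClosure (𝓞 k) Ω) :=
      continuousSMul_iff_stabilizer_isOpen.mpr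
        (Literature.NumberTheory.GaloisRepresentations.stabilizer_integralClosure_isOpen (𝓞 k))
    let N : Subgroup (Ω ≃ₐ[k] Ω) := L.fixingSubgroup
    have hN : IsClosed (N : Set (Ω ≃ₐ[k] Ω)) := IntermediateField.fixingSubgroup_isClosed L
    let g₀ : Ω ≃ₐ[k] Ω := AlgEquiv.liftNormal g Ω
    have hg₀ : ∀ x : L, g₀ (x : Ω) = (g x : Ω) := fun x ↦ AlgEquiv.liftNormal_commutes g Ω x
    have hg₀inv : ∀ b : integralClosure (𝓞 k) Ω, (∀ m ∈ N, m • b = b) → g₀ • b - b ∈ 𝔓 := by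
      intro b hb
      have hbL : (b : Ω) ∈ L := by
        rw [← InfiniteGalois.fixedField_fixingSubgroup L, IntermediateField.mem_fixedField_iff]
        intro f hf
        have := congrArg Subtype.val (hb f hf)
        rwa [integralClosure.coe_smul] at this
      have hbint : IsIntegral ℤ (⟨(b : Ω), hbL⟩ : L) := by
        rw [← isIntegral_algebraMap_iff (algebraMap L Ω).injective]
        exact isIntegral_trans (R := ℤ) (A := 𝓞 k) (b : Ω) b.2
      set x : 𝓞 L := ⟨⟨(b : Ω), hbL⟩, hbint⟩ with hxdef
      have hbx : b = ι x := Subtype.ext rfl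
      have hgx : g • x - x ∈ P := hg x
      rw [hPdef, Ideal.mem_comap, map_sub] at hgx
      rw [hbx]
      convert hgx using 2
      apply Subtype.ext
      rw [integralClosure.coe_smul, coe_ringOfIntegersToIntegralClosure,
        coe_ringOfIntegersToIntegralClosure]
      exact hg₀ x
    obtain ⟨m₁, hm₁, m₂, hm₂, hσ⟩ :=
      exists_mul_mul_mem_inertia N hN 𝔓 g₀ hg₀inv
    refine ⟨m₁ * g₀ * m₂, hσ, fun x ↦ ?_⟩
    have hm₂x : m₂ (x : Ω) = x := (IntermediateField.mem_fixingSubgroup_iff _ _).mp hm₂ _ x.2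
    have hm₁x : m₁ (g₀ (x : Ω)) = g₀ x := by
      rw [hg₀]
      exact (IntermediateField.mem_fixingSubgroup_iff _ _).mp hm₁ _ (g x).2
    rw [AlgEquiv.mul_apply, AlgEquiv.mul_apply, hm₂x, hm₁x, hg₀]
  -- ### Step 2: `#I = e(P ∣ w)`
  have hcardI : Nat.card I = w.asIdeal.ramificationIdx' P := by
    haveI := w.isPrime
    rw [Ideal.ramificationIdx'_eq_ramificationIdx w.asIdeal P w.ne_bot,
      ← Ideal.ramificationIdxIn_eq_ramificationIdx w.asIdeal P G,
      ← Ideal.card_inertia_eq_ramificationIdxIn (G := G) w.asIdeal P]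
  -- ### Step 3: `e(P ∣ w) ≥ 2` — the Eisenstein element `z`
  have hzP : z ∈ P := by
    have hz2 : z * z ∈ P := by
      have e : z * z = z * (z - 2 * cL) + algebraMap (𝓞 k) (𝓞 L) (2 * c) * z := by
        rw [map_mul, hcLdef]; simp only [map_ofNat]; ring
      rw [e, hzz]
      refine P.add_mem (hmemP _ ?_) (P.mul_mem_right _ (hmemP _ h2c))
      exact (w.intValuation_lt_one_iff_mem _).mp (by rw [hπ, ← WithZero.exp_zero, WithZero.exp_lt_exp]; norm_num)
    exact (hPprime.mem_or_mem hz2).elim id id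
  have hz2P : z - 2 * cL ∈ P := by
    refine P.sub_mem hzP ?_
    have e : (2 : 𝓞 L) * cL = algebraMap (𝓞 k) (𝓞 L) (2 * c) := by rw [map_mul, hcLdef]; simp only [map_ofNat]
    rw [e]
    exact hmemP _ h2c
  have he2 : 2 ≤ w.asIdeal.ramificationIdx' P := by
    change 2 ≤ w.asIdeal.ramificationIdx' wP.asIdeal
    have hval := HeightOneSpectrum.intValuation_liesOver w wP (u - c ^ 2)
    rw [hπ, ← hzz, map_mul] at hval
    have h1 : wP.intValuation z ≤ WithZero.exp (-((1 : ℕ) : ℤ)) := by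
      rw [HeightOneSpectrum.intValuation_le_pow_iff_mem, pow_one]; exact hzP
    have h2 : wP.intValuation (z - 2 * cL) ≤ WithZero.exp (-((1 : ℕ) : ℤ)) := by
      rw [HeightOneSpectrum.intValuation_le_pow_iff_mem, pow_one]; exact hz2P
    have h12 := mul_le_mul' h1 h2
    rw [← hval, ← WithZero.exp_add, ← WithZero.exp_nsmul, WithZero.exp_le_exp] at h12
    simp only [Nat.cast_one, smul_neg, nsmul_eq_mul, mul_one] at h12
    omega
  -- ### Step 4: a non-trivial inertia element of `Gal(L/k)` negates `η`; lift it
  have hI2 : 1 < Nat.card I := by rw [hcardI]; omega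
  have hIbot : I ≠ ⊥ := by
    intro hbot
    rw [hbot, Subgroup.card_bot] at hI2
    exact lt_irrefl _ hI2
  obtain ⟨⟨g, hgI⟩, hg1⟩ := Subgroup.ne_bot_iff_exists_ne_one.mp hIbot
  replace hg1 : g ≠ 1 := fun h ↦ hg1 (Subtype.ext h)
  have hgη : g η' ≠ η' := by
    intro h
    apply hg1
    refine algEquiv_adjoin_eq_one_of_forall_apply_eq g fun s hs hs' ↦ ?_
    rw [Set.mem_singleton_iff] at hs'
    subst hs'
    exact congrArg Subtype.val h
  have hgη' : g η' = -η' := by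
    have hsq : (g η') ^ 2 = η' ^ 2 := by rw [← map_pow, hη'sq, AlgEquiv.commutes]
    exact (sq_eq_sq_iff_eq_or_eq_neg.mp hsq).resolve_left hgη
  obtain ⟨σ, hσI, hσ⟩ := hlift g hgI
  refine ⟨σ, hσI, ?_⟩
  have h := hσ η'
  rw [hgη'] at h
  exact h

/-- **Specialisation to `Γ_k` and `√u ∈ k̄`** (`Ω = k̄`, `\bar ℤ_k = absIntegers (𝓞 k) k`, `𝔓 ∈ w.primesAbove`, conventions of
`IntegralGaloisAction`): for `u, c ∈ 𝓞 k` with `2c ∈ w` and `u − c²` a uniformizer at `w`, some `σ ∈ I_𝔓 ≤ Γ_k` has `σ√u = −√u`.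
[cite: SerreLocalFields1979, Ch. I §6 Prop. 17–18] [cite: Lang1983, Ch. 6 Prop. 1.3] -/
theorem exists_mem_inertia_smul_geomSqrt_eq_neg_of_sq_sub_uniformizer (w : HeightOneSpectrum (𝓞 k)) {u c : 𝓞 k}
    (h2c : 2 * c ∈ w.asIdeal) (hπ : w.intValuation (u - c ^ 2) = WithZero.exp (-1 : ℤ))
    {𝔓 : Ideal (absIntegers (𝓞 k) k)} (h𝔓 : 𝔓 ∈ w.primesAbove) :
    ∃ σ : absoluteGaloisGroup k, σ ∈ 𝔓.inertia (absoluteGaloisGroup k) ∧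
      σ • geomSqrt (u : k) = -geomSqrt (u : k) :=
  @exists_mem_inertia_apply_eq_neg_of_sq_sub_uniformizer k _ _ (AlgebraicClosure k) _ _ _ w u c h2c hπ
    (geomSqrt (u : k)) (geomSqrt_sq (u : k)) 𝔓 h𝔓.1 h𝔓.2

/-- **The same in the tree's `GreenbergSelmer.inertia` currency** (`I_w = I_{𝔓₀}`, `𝔓₀ = adicCompletionPrime k w`, the inertia group of
the prime cut out by the chosen embedding `k̄ → k̄_w`; `inertia_adicCompletionPrime_eq_map_absInertia`): some `τ ∈ I_w` negates `√u`.
[cite: NeukirchANT1999, Ch. II §9 Prop. (9.6)] [cite: SerreLocalFields1979, Ch. I §6 Prop. 17–18] -/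
theorem exists_mem_greenbergInertia_smul_geomSqrt_eq_neg_of_sq_sub_uniformizer (w : HeightOneSpectrum (𝓞 k)) {u c : 𝓞 k}
    (h2c : 2 * c ∈ w.asIdeal) (hπ : w.intValuation (u - c ^ 2) = WithZero.exp (-1 : ℤ)) :
    ∃ τ ∈ GreenbergSelmer.inertia w, τ • geomSqrt (u : k) = -geomSqrt (u : k) := by
  have e : GreenbergSelmer.inertia w = (adicCompletionPrime k w).inertia (absoluteGaloisGroup k) :=
    (inertia_adicCompletionPrime_eq_map_absInertia k w).symm
  obtain ⟨σ, hσ, hσu⟩ := exists_mem_inertia_smul_geomSqrt_eq_neg_of_sq_sub_uniformizer w h2c hπ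
    (adicCompletionPrime_mem_primesAbove k w)
  exact ⟨σ, e ▸ hσ, hσu⟩

end Wild

/-! ## §2. Kummer parity: inertia fixing `√γ` forces `ord_w(γ)` even; the wild exclusion in stabiliser form -/

section Parity

variable {k : Type u} [Field k] [NumberField k]

/-- **If `I_w ≤ Stab(√γ)` then `2 ∣ ord_w(γ)`** — at EVERY finite place `w`, tame or wild (the tree's Kummer criterion
`dvd_log_valuation_of_absoluteGaloisGroup_inertia_fixes_root` with `ζ = −1`, `d = 2`, read at `𝔓₀ = adicCompletionPrime k w`).
[cite: Lang1983, Ch. 6 Prop. 1.3 («only if»)] [cite: SilvermanAEC2009, Prop. VIII.1.6 (proof)] -/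
theorem two_dvd_log_valuation_of_inertia_le_stabilizer (w : HeightOneSpectrum (𝓞 k)) {γ : k} (hγ : γ ≠ 0)
    (h : GreenbergSelmer.inertia w ≤ MulAction.stabilizer (absoluteGaloisGroup k) (geomSqrt γ)) :
    (2 : ℤ) ∣ WithZero.log (w.valuation k γ) := by
  have hζ : IsPrimitiveRoot (-1 : k) 2 := IsPrimitiveRoot.neg_one 0 (by decide)
  have e : GreenbergSelmer.inertia w = (adicCompletionPrime k w).inertia (absoluteGaloisGroup k) :=
    (inertia_adicCompletionPrime_eq_map_absInertia k w).symm
  have h2 := dvd_log_valuation_of_absoluteGaloisGroup_inertia_fixes_root (d := 2) two_pos hζ hγ (geomSqrt_sq γ) w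
    (adicCompletionPrime_mem_primesAbove k w) (fun σ hσ ↦ MulAction.mem_stabilizer_iff.mp (h (e ▸ hσ)))
  exact_mod_cast h2

/-- **WILD EXCLUSION, stabiliser form**: for `u, c ∈ 𝓞 k` with `2c ∈ w`, `u − c²` a uniformizer at `w` and `u ≠ 0`, the inertia
group `I_w` is NOT contained in `Stab(√u)` (`k(√u)/k` ramifies at `w`), although `ord_w(u) = 0` may well be even — the parity
criterion is silent at the wild place, the Eisenstein element is not. [cite: SerreLocalFields1979, Ch. I §6 Prop. 17–18] -/
theorem not_inertia_le_stabilizer_geomSqrt_of_sq_sub_uniformizer (w : HeightOneSpectrum (𝓞 k)) {u c : 𝓞 k}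
    (hu : (u : k) ≠ 0) (h2c : 2 * c ∈ w.asIdeal) (hπ : w.intValuation (u - c ^ 2) = WithZero.exp (-1 : ℤ)) :
    ¬ GreenbergSelmer.inertia w ≤ MulAction.stabilizer (absoluteGaloisGroup k) (geomSqrt (u : k)) := by
  intro h
  obtain ⟨τ, hτ, hτu⟩ := exists_mem_greenbergInertia_smul_geomSqrt_eq_neg_of_sq_sub_uniformizer w h2c hπ
  have hfix : τ • geomSqrt (u : k) = geomSqrt (u : k) := MulAction.mem_stabilizer_iff.mp (h hτ)
  rw [hfix] at hτu
  exact geomSqrt_ne_neg hu hτu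

end Parity

end Summit.BirchSwinnertonDyer.BirchSwinnertonDyer.Theorems.PrintCf2.FirstLayer

end
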